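import Summits.QuantumFields.BalabanUV.Beta.HessKerDressedUnits

/-!
# `BalabanUV.Beta.HessKerDressWithUnit` — the leg-units invariance of the dressed resolvent Hessian kernel for an ARBITRARY dressing
# commuting with the units (asymptotic lane asym1, gen 89, v1; generic `d`; bookkeeping only; one import; one theorem)

ANSWERS the NAMED «INTERFACE REQUEST asym1: `hessKer_dressWith_unit`» of row D1's owner beta-d1-p3 (gen 14) under RULING R-FP-45
(pub-balaban CLAIMS.log l.33687, INBOX.md l.13261; OWNER GO to d1-formalise-leaf-06 l.33582 item (vi) «units `hPu`»): the type below is the one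
quoted there verbatim (= asym1 gen 87 scratch (J2), WORD W-asym1-g87-1).  Consumers named by the owner: the NESTED-DRESS kernelisation file
(leaf-06; `Π^{(m)}_nest`-dressing, `FP/NestedDressingProjector*`) and the SDF-EXACT road instance (owner).  FREEZE (0): a new ONE-IMPORT LEAF on a
named interface request; NOTHING in `HessKerDressedUnits` (or anywhere else) is edited.

HONEST FRAMING (cell contract, verbatim): «discharging `BetaPertH` makes Bałaban's UV stability UNCONDITIONAL — a real
constructive-QFT result; it is NOT the continuum limit and NOT the Clay problem.»  THIS MODULE is elementary algebra on matrix-fibred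
lattice kernels (a diagonal conjugation passes through `hessKer`); it formalises NO statement printed in Bałaban's papers, cites none as a
hypothesis, mints no `Prop` fact, instantiates NO binder of the wall and DISCHARGES NOTHING of it.  NOT summit progress.  NOT IN PRINT — OUR
BOOKKEEPING.  NOT (CONV-C), NOT D1, NEVER «G-an2-4 closed», NOT `BetaPertH`, NOT continuum, NOT Clay.
HONEST DEPENDENCY: continuum YM on T⁴ ⇐ BetaPertH ∧ nine spine estimates (0/9 proved); BetaPertH ⇐ (D1) ∧ (D4) ∧ CAP+tail; G-an2-4 gates
asym, D1 and NE2/3/4.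

ABSOLUTE RULE (cell, verbatim): «No internally-minted statement may enter as a cited fact. Every hypothesis is either
kernel-proved in this package or a verbatim quotation of a PUBLISHED theorem with page reference. The manuscript(s) under
audit are NOT citable for their own disputed steps — they are the thing under adjudication; programme-internal
(2001/route/tribunal) claims are never citable.»  The theorem below is kernel-proved from explicit, abstract hypotheses; [folklore].

PLACEMENT.  New cell work about the cell's typed objects (a CELL RESULT, β-lead RULING (R34-2)) under the registered cell topic
`Summits/QuantumFields/BalabanUV/Beta/`; a one-import leaf of `HessKerDressedUnits` (≤ 400 lines; imported by nothing under `Literature/`).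

WHY.  `HessKerDressedUnits.hessKer_dress_unit` proves the units invariance `hessKer (Π(DKD)) (V^Π_{DKD}(unitS S)) (unitW W) = hessKer (ΠK) (V^Π_K S) W`
for an2's axial dressing `Π = axDressK N` / `axVertexOfK`, and its proof uses exactly TWO facts about the dressing: it commutes with the covariant
leg units on the kernel (`axDressK_unitK`) and its dressed chain-rule vertex transforms contragrediently (`axVertexOfK_unit`).  Row D1's roads now
dress with OTHER projectors (R-FP-45 (B): the nested block-mean dressing `Π^{(m)}_nest`; the SDF-EXACT instance), for which the consumers prove
those two commutations themselves (leaf-06's units letter `hPu`).  The theorem below is the same invariance with the dressing ABSTRACTED: ANY map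
`Pn` on kernels with `Pn (unitK K) = unitK (Pn K)` (`hPu`) and ANY dressed vertex `Vn` with `Vn (unitK K) (unitS S) μ y = counitK (Vn K S μ y)` (`hVu`)
— so each consumer instantiates it BY NAME with its own two letters and re-proves nothing about `hessKer`.  NO normalised object is named, NO
exponent asserted, NO projector of the tree is constrained.

CONTENT (no `def`, no `Prop`; one theorem + one `example`): **`hessKer_dressWith_unit`** — for nonzero leg units `(s_f, s_m)` and `Pn`, `Vn` as
above, `hessKer (Pn (unitK K)) (Vn (unitK K) (unitS S)) (unitW W) = hessKer (Pn K) (Vn K S) W` (`HessKerRate.hessKer_scaleK` BY NAME with `u = D`,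
`u′ = D⁻¹`, as in `hessKer_dress_unit`); the `example` re-derives the tree's instance `hessKer_dress_unit` from it with `Pn := axDressK N`,
`Vn K S := axVertexOfK K N S` (`axDressK_unitK`, `axVertexOfK_unit` BY NAME) — the dedup check that the abstraction is the right one.
RELATION TO THE TREE (no duplication): `unitK` ∕ `counitK` ∕ `unitS` ∕ `unitW` ∕ `legScale` ∕ `legScale_mul_legScale_inv` ∕ `axDressK_unitK` ∕
`axVertexOfK_unit` of `HessKerDressedUnits` and `HessKerRate.hessKer_scaleK` are USED BY NAME; new here is only the abstraction over the dressing.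
NOT continuum, NOT Clay.
-/

open Literature.MathematicalPhysics.QuantumFieldTheory.Balaban1983to89
open Literature.MathematicalPhysics.QuantumFieldTheory.Balaban1983to89.Beta
open ExpKernelCalculus (MKer hessKer)
open HessKerRate (hessKer_scaleK)
open OneStepResolventKernel (Fib)
open AxialDressing (axDressK axVertexOfK)
open Summit.QuantumFields.BalabanUV.Beta.HessKerDressedUnits

namespace Summit.QuantumFields.BalabanUV.Beta.HessKerDressWithUnit

variable {d : ℕ}

/-- [folklore] **UNITS INVARIANCE OF THE DRESSED RESOLVENT HESSIAN KERNEL, GENERIC DRESSING**: for nonzero leg units `(s_f, s_m)`, ANY dressing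
`Pn` of kernels commuting with the covariant units (`hPu : Pn (D K D) = D (Pn K) D`) and ANY dressed vertex `Vn` transforming contragrediently
(`hVu : Vn (D K D) (unitS S) μ y = D⁻¹ (Vn K S μ y) D⁻¹`),
`hessKer (Pn (D K D)) (Vn (D K D) (unitS S)) (unitW W) = hessKer (Pn K) (Vn K S) W`
(`hPu`, `hVu`, then `HessKerRate.hessKer_scaleK` with `u = D = legScale s_f s_m`, `u′ = D⁻¹`).  The tree's `hessKer_dress_unit` is the instance
`Pn := axDressK N`, `Vn K S := axVertexOfK K N S` (see the `example` below); row D1's nested ∕ SDF dressings are the consumers' instances. -/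
theorem hessKer_dressWith_unit {sf sm : ℝ} (hsf : sf ≠ 0) (hsm : sm ≠ 0)
    (Pn : MKer (d + 1) (Fib d) → MKer (d + 1) (Fib d)) (hPu : ∀ K, Pn (unitK sf sm K) = unitK sf sm (Pn K))
    (Vn : MKer (d + 1) (Fib d) → (Fin (d + 1) → (Fin (d + 1) → ℤ) → MKer (d + 1) (Fib d)) →
      Fin (d + 1) → (Fin (d + 1) → ℤ) → MKer (d + 1) (Fib d))
    (hVu : ∀ K S μ y, Vn (unitK sf sm K) (unitS sf sm S) μ y = counitK sf sm (Vn K S μ y))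
    (K : MKer (d + 1) (Fib d)) (S : Fin (d + 1) → (Fin (d + 1) → ℤ) → MKer (d + 1) (Fib d))
    (W : Fin (d + 1) → (Fin (d + 1) → ℤ) → Fin (d + 1) → (Fin (d + 1) → ℤ) → MKer (d + 1) (Fib d)) :
    hessKer (Pn (unitK sf sm K)) (Vn (unitK sf sm K) (unitS sf sm S)) (unitW sf sm W) = hessKer (Pn K) (Vn K S) W := by
  have hV : Vn (unitK sf sm K) (unitS sf sm S) = fun μ y => counitK sf sm (Vn K S μ y) :=
    funext fun μ => funext fun y => hVu K S μ y
  rw [hPu, hV]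
  exact hessKer_scaleK (legScale sf sm) (legScale sf⁻¹ sm⁻¹) (legScale_mul_legScale_inv hsf hsm) (Pn K) (Vn K S) W

/-- [folklore] The tree's instance, re-derived (dedup check, not a new statement): an2's `Π`-dressing satisfies `hPu` ∕ `hVu`
(`axDressK_unitK`, `axVertexOfK_unit`), so `hessKer_dressWith_unit` specialises to `HessKerDressedUnits.hessKer_dress_unit`. -/
example {sf sm : ℝ} (hsf : sf ≠ 0) (hsm : sm ≠ 0) (N : ℕ) (K : MKer (d + 1) (Fib d))
    (S : Fin (d + 1) → (Fin (d + 1) → ℤ) → MKer (d + 1) (Fib d))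
    (W : Fin (d + 1) → (Fin (d + 1) → ℤ) → Fin (d + 1) → (Fin (d + 1) → ℤ) → MKer (d + 1) (Fib d)) :
    hessKer (axDressK N (unitK sf sm K)) (axVertexOfK (unitK sf sm K) N (unitS sf sm S)) (unitW sf sm W) =
      hessKer (axDressK N K) (axVertexOfK K N S) W :=
  hessKer_dressWith_unit hsf hsm (axDressK N) (axDressK_unitK N sf sm) (fun K S => axVertexOfK K N S)
    (fun K S μ y => axVertexOfK_unit hsf hsm K N S μ y) K S W

end Summit.QuantumFields.BalabanUV.Beta.HessKerDressWithUnit
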